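import Mathlib
import Literature.NumberTheory.NumberFields.KurodaRelationOddPart
import HarnessLib

/-!
# Non-square descent — THE CUBIC ISOTYPIC SPLITTING OF CLASS GROUPS: `#Cl(L)[q] = #Cl(L^σ)[q] · #{c ∈ Cl(L)[q] : c·σc·σ²c = 1}` for
# `σ ∈ Gal(L/F)` with `σ³ = 1` and `gcd(q, 3) = 1` — the ARITHMETIC step «`#A(M_n)[2^∞] = #A(K_n)[2^∞] · #A_n^χ`» of stub S2's index-theorem
# comparison (line `nonsquare-descent`) — seed crux `SignedMuSeedAtTwoPlus` stmt-BirchSwinnertonDyer-21438 (parent Kμ⁺ `SignedMuVanishingAtTwoPlus`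
# stmt-BirchSwinnertonDyer-20689, route ResidualThetaTransportAtTwo), line card `Cruxes/SignedMuSeedAtTwoPlus/Lines/nonsquare-descent.md`

Cell `bsd-wall`, width seat `bsd-wall-rtt-p4-w2` g19 (`--supports`, closes nothing).  THEOREMS ONLY; BSD is not proved by this.  Unlike its
companions this file is ARITHMETIC (number fields), built on the tree's class-group Galois machinery: `classGroupNorm`/`classGroupExtend`
(Neukirch III (1.6) (ii) `N∘i = (·)^{[L:K]}`, (iv) `i∘N = ∏_σ σ`), the Galois action `ClassGroup.mulEquiv (AmbiguousClass.intAut σ)`, and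
`KurodaOddPart.card_torsion_fixed_eq_card_torsion_fixedField` (`#Cl(L)[q]^H = #Cl(L^H)[q]` for `gcd(q, [L:L^H]) = 1`).

In stub S2, `M_n/K_n` is cyclic cubic (`Δ = ⟨δ⟩`, `3 ∈ ℤ₂ˣ`), and the comparison `e_n(M) = e_n(K) + ord₂ #A_n^χ` used by
`…GrowthComparison.classicalMuVanishes_of_comparison_with_base` reads `#A(M_n)[2^N] = #A(M_n)[2^N]^Δ · #(norm-kernel) = #A(K_n)[2^N] · #A_n^χ[2^N]`
(`A^χ` = the `(1 − e₁)`-part = the kernel of `1 + δ + δ²`).  Here: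

* §1 (finite commutative groups) `pow_three_comp_eq`, **`card_eq_card_fixed_mul_card_normKer`** — for an endomorphism `s` with `s³ = 1` and an `s`-stable
  subgroup `N` all of whose elements satisfy `m^q = 1`, `gcd(3, q) = 1`: `#N = #{m ∈ N : s m = m} · #{m ∈ N : m·s m·s²m = 1}` (the trace `m ↦ m·sm·s²m`
  maps `N` onto its `s`-fixed part — `u = T(u^a)` for `3a ≡ 1 (mod q)` — with kernel the norm-kernel); the order-`3` twin of the tree's involution lemma
  in `KurodaRelationOddPart`.
* §2 (number fields, `L/F` Galois, `σ ∈ Gal(L/F)`, `σ³ = 1`, `gcd(3, q) = 1`) `fixed_zpowers_iff`, `coprime_finrank_fixedField_zpowers`,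
  **`card_torsion_classGroup_eq_card_fixedField_mul_card_normKer`**:
  `#{c ∈ Cl(L) : c^q = 1} = #{d ∈ Cl(L^{⟨σ⟩}) : d^q = 1} · #{c ∈ Cl(L) : c^q = 1 ∧ c·σc·σ²c = 1}`.
  With `q = 2^N ≥ exp Cl(L)[2^∞]` this is the ORDER statement `#Cl(M_n)[2^∞] = #Cl(K_n)[2^∞] · #A_n^χ`.

[folklore]
-/

set_option autoImplicit false
-- the Theorems namespace of this sub repeats the summit name by design (D-0017 nested layout)
set_option linter.dupNamespace false

namespace Summit.BirchSwinnertonDyer.BirchSwinnertonDyer.Theorems.SignedMuAtTwo.NonsquareDescent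

/-! ## §1 Finite commutative groups with an endomorphism of order dividing `3` -/

section Group

variable {M : Type*} [CommGroup M]

/-- `s` fixes the trace `m · s m · s² m` when `s³ = 1`. [folklore] -/
theorem apply_trace_eq (s : M →* M) (hs3 : ∀ m, s (s (s m)) = m) (m : M) :
    s (m * s m * s (s m)) = m * s m * s (s m) := by
  rw [map_mul, map_mul, hs3]
  -- `s m * s² m * m = m * s m * s² m`
  rw [mul_comm (s m * s (s m)) m, mul_assoc]

/-- **`#N = #N^s · #ker(1 + s + s²)|_N`** for an endomorphism `s` with `s³ = 1` of a commutative group, an `s`-stable subgroup `N` and `q` prime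
to `3` with `m^q = 1` on `N`: the trace `T m = m·s m·s²m` maps `N` onto `{m ∈ N : s m = m}` (`u = T(u^a)`, `3a ≡ 1 mod q`) with kernel
`{m ∈ N : m·s m·s²m = 1}`.  (Order-`3` twin of `KurodaRelationOddPart`'s involution lemma.) [folklore] -/
theorem card_eq_card_fixed_mul_card_normKer (N : Subgroup M) [Finite N] (s : M →* M)
    (hs3 : ∀ m, s (s (s m)) = m) (hN : ∀ m ∈ N, s m ∈ N) {q : ℕ} (hq : Nat.Coprime 3 q)
    (hNq : ∀ m ∈ N, m ^ q = 1) :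
    Nat.card N = Nat.card {m : M // m ∈ N ∧ s m = m} * Nat.card {m : M // m ∈ N ∧ m * s m * s (s m) = 1} := by
  classical
  -- the trace as an endomorphism of `N`
  let T : N →* N :=
    { toFun := fun m => ⟨m.1 * s m.1 * s (s m.1), N.mul_mem (N.mul_mem m.2 (hN _ m.2)) (hN _ (hN _ m.2))⟩
      map_one' := Subtype.ext (by simp only [OneMemClass.coe_one, map_one, mul_one])
      map_mul' := fun x y => Subtype.ext (by
        simp only [Subgroup.coe_mul, map_mul]
        ac_rfl) }
  have hT : ∀ m : N, ((T m : N) : M) = m.1 * s m.1 * s (s m.1) := fun m => rfl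
  -- `#N = #(N ⧸ ker T) · #ker T = #range T · #ker T`
  have h1 : Nat.card N = Nat.card T.range * Nat.card T.ker := by
    rw [Subgroup.card_eq_card_quotient_mul_card_subgroup T.ker,
      Nat.card_congr (QuotientGroup.quotientKerEquivRange T).toEquiv]
  -- Bezout: `3 a + q b = 1`
  have hbez : (3 : ℤ) * Nat.gcdA 3 q + (q : ℤ) * Nat.gcdB 3 q = 1 := by
    have h := Nat.gcd_eq_gcd_ab 3 q
    rw [Nat.Coprime.gcd_eq_one hq] at h
    exact_mod_cast h.symm
  set a := Nat.gcdA 3 q with ha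
  -- the range of `T` is the `s`-fixed part of `N`
  have hrange : ∀ u : N, u ∈ T.range ↔ s u.1 = u.1 := by
    intro u
    constructor
    · rintro ⟨m, rfl⟩
      rw [hT]
      exact apply_trace_eq s hs3 m.1
    · intro hu
      refine ⟨u ^ a, Subtype.ext ?_⟩
      rw [hT, SubgroupClass.coe_zpow, map_zpow, map_zpow, hu, hu, ← zpow_add, ← zpow_add]
      have hq1 : (u.1 : M) ^ ((q : ℤ) * Nat.gcdB 3 q) = 1 := by
        rw [zpow_mul, zpow_natCast, hNq _ u.2, one_zpow]
      calc (u.1 : M) ^ (a + a + a) = (u.1 : M) ^ ((3 : ℤ) * a) * (u.1 : M) ^ ((q : ℤ) * Nat.gcdB 3 q) := by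
            rw [hq1, mul_one]; congr 1; ring
        _ = u.1 := by rw [← zpow_add, hbez, zpow_one]
  have h2 : Nat.card T.range = Nat.card {m : M // m ∈ N ∧ s m = m} := by
    refine Nat.card_congr
      { toFun := fun u => ⟨u.1.1, u.1.2, (hrange u.1).1 u.2⟩
        invFun := fun m => ⟨⟨m.1, m.2.1⟩, (hrange ⟨m.1, m.2.1⟩).2 m.2.2⟩
        left_inv := fun u => rfl
        right_inv := fun m => rfl }
  have h3 : Nat.card T.ker = Nat.card {m : M // m ∈ N ∧ m * s m * s (s m) = 1} := by
    refine Nat.card_congr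
      { toFun := fun u => ⟨u.1.1, u.1.2, by
          have h := u.2
          rw [MonoidHom.mem_ker] at h
          have h' := congrArg Subtype.val h
          rw [hT] at h'
          exact h'⟩
        invFun := fun m => ⟨⟨m.1, m.2.1⟩, by
          rw [MonoidHom.mem_ker]
          exact Subtype.ext m.2.2⟩
        left_inv := fun u => rfl
        right_inv := fun m => rfl }
  rw [h1, h2, h3]

end Group

/-! ## §2 Class groups of a Galois extension with an automorphism of order dividing `3` -/

section ClassGroup

open NumberField IntermediateField Literature.NumberTheory.NumberFields

variable (F L : Type) [Field F] [NumberField F] [Field L] [NumberField L] [Algebra F L] [IsGalois F L]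

omit [NumberField F] [IsGalois F L] in
/-- Iterating the Galois action on classes: `(σ^k) • c = σ • … • σ • c`. [folklore] -/
theorem mulEquiv_intAut_pow (σ : L ≃ₐ[F] L) (c : ClassGroup (𝓞 L)) (k : ℕ) :
    ClassGroup.mulEquiv (AmbiguousClass.intAut (σ ^ k)) c = (ClassGroup.mulEquiv (AmbiguousClass.intAut σ))^[k] c := by
  induction k with
  | zero => rw [pow_zero, AmbiguousClass.mulEquiv_intAut_one, MulEquiv.refl_apply, Function.iterate_zero, id]
  | succ k ih =>
    rw [pow_succ, AmbiguousClass.mulEquiv_intAut_mul, MulEquiv.trans_apply, Function.iterate_succ_apply', ← ih]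
    -- `σ^k * σ` versus `σ * σ^k`: both iterate to the same
    rw [← MulEquiv.trans_apply, ← AmbiguousClass.mulEquiv_intAut_mul, ← MulEquiv.trans_apply,
      ← AmbiguousClass.mulEquiv_intAut_mul, ← pow_succ, ← pow_succ']

omit [IsGalois F L] in
/-- A class is fixed by the cyclic group `⟨σ⟩` iff it is fixed by `σ`. [folklore] -/
theorem fixed_zpowers_iff (σ : L ≃ₐ[F] L) (c : ClassGroup (𝓞 L)) :
    (∀ τ ∈ Subgroup.zpowers σ, ClassGroup.mulEquiv (AmbiguousClass.intAut τ) c = c) ↔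
      ClassGroup.mulEquiv (AmbiguousClass.intAut σ) c = c := by
  haveI : FiniteDimensional F L := Module.Finite.of_restrictScalars_finite ℚ F L
  constructor
  · intro h
    exact h σ (Subgroup.mem_zpowers σ)
  · intro h τ hτ
    rw [← mem_powers_iff_mem_zpowers, Submonoid.mem_powers_iff] at hτ
    obtain ⟨k, rfl⟩ := hτ
    rw [mulEquiv_intAut_pow]
    exact Function.iterate_fixed h k

omit [IsGalois F L] in
/-- `[L : L^{⟨σ⟩}] = ord σ` divides `3` when `σ³ = 1`, so it is prime to any `q` prime to `3`. [folklore] -/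
theorem coprime_finrank_fixedField_zpowers (σ : L ≃ₐ[F] L) (hσ : σ ^ 3 = 1) {q : ℕ} (hq : Nat.Coprime 3 q) :
    Nat.Coprime (Module.finrank ↥(fixedField (Subgroup.zpowers σ)) L) q := by
  haveI : FiniteDimensional F L := Module.Finite.of_restrictScalars_finite ℚ F L
  rw [finrank_fixedField_eq_card, Nat.card_zpowers]
  exact Nat.Coprime.coprime_dvd_left (orderOf_dvd_of_pow_eq_one hσ) hq

/-- **CUBIC ISOTYPIC SPLITTING OF THE `q`-TORSION OF THE CLASS GROUP**: for `L/F` Galois, `σ ∈ Gal(L/F)` with `σ³ = 1` and `gcd(3, q) = 1`,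
`#{c ∈ Cl(L) : c^q = 1} = #{d ∈ Cl(L^{⟨σ⟩}) : d^q = 1} · #{c ∈ Cl(L) : c^q = 1 ∧ c·σc·σ²c = 1}`
(«`#A(M_n)[2^N] = #A(K_n)[2^N] · #A_n^χ[2^N]`», `A^χ` = the norm-kernel = the `(1−e₁)`-part; with `2^N ≥ exp` the ORDER statement).
§1 on `N = Cl(L)[q]`, `s = σ`, then the tree's `KurodaOddPart.card_torsion_fixed_eq_card_torsion_fixedField`. [folklore] -/
theorem card_torsion_classGroup_eq_card_fixedField_mul_card_normKer (σ : L ≃ₐ[F] L) (hσ : σ ^ 3 = 1)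
    {q : ℕ} (hq : Nat.Coprime 3 q) :
    Nat.card {c : ClassGroup (𝓞 L) // c ^ q = 1} =
      Nat.card {d : ClassGroup (𝓞 ↥(fixedField (Subgroup.zpowers σ))) // d ^ q = 1} *
        Nat.card {c : ClassGroup (𝓞 L) // c ^ q = 1 ∧
          c * ClassGroup.mulEquiv (AmbiguousClass.intAut σ) c *
            ClassGroup.mulEquiv (AmbiguousClass.intAut σ) (ClassGroup.mulEquiv (AmbiguousClass.intAut σ) c) = 1} := by
  classical
  set s : ClassGroup (𝓞 L) →* ClassGroup (𝓞 L) := (ClassGroup.mulEquiv (AmbiguousClass.intAut σ)).toMonoidHom with hs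
  have hs_apply : ∀ c, s c = ClassGroup.mulEquiv (AmbiguousClass.intAut σ) c := fun c => rfl
  have hs3 : ∀ c, s (s (s c)) = c := by
    intro c
    rw [hs_apply, hs_apply, hs_apply, ← MulEquiv.trans_apply, ← AmbiguousClass.mulEquiv_intAut_mul, ← MulEquiv.trans_apply,
      ← AmbiguousClass.mulEquiv_intAut_mul, ← pow_two, ← pow_succ, hσ, AmbiguousClass.mulEquiv_intAut_one, MulEquiv.refl_apply]
  set N : Subgroup (ClassGroup (𝓞 L)) := (powMonoidHom q).ker with hNdef
  have hmemN : ∀ c, c ∈ N ↔ c ^ q = 1 := fun c => by rw [hNdef, MonoidHom.mem_ker, powMonoidHom_apply]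
  have hN : ∀ c ∈ N, s c ∈ N := fun c hc => by
    rw [hmemN] at hc ⊢
    rw [← map_pow, hc, map_one]
  have hNq : ∀ c ∈ N, c ^ q = 1 := fun c hc => (hmemN c).1 hc
  have key := card_eq_card_fixed_mul_card_normKer N s hs3 hN hq hNq
  -- identify the three counts
  have e1 : Nat.card N = Nat.card {c : ClassGroup (𝓞 L) // c ^ q = 1} :=
    Nat.card_congr (Equiv.subtypeEquivRight fun c => hmemN c)
  have e2 : Nat.card {c : ClassGroup (𝓞 L) // c ∈ N ∧ s c = c} =
      Nat.card {d : ClassGroup (𝓞 ↥(fixedField (Subgroup.zpowers σ))) // d ^ q = 1} := by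
    rw [← KurodaOddPart.card_torsion_fixed_eq_card_torsion_fixedField F L (Subgroup.zpowers σ)
      (coprime_finrank_fixedField_zpowers F L σ hσ hq)]
    refine Nat.card_congr (Equiv.subtypeEquivRight fun c => ?_)
    rw [hmemN, hs_apply, fixed_zpowers_iff]
  have e3 : Nat.card {c : ClassGroup (𝓞 L) // c ∈ N ∧ c * s c * s (s c) = 1} =
      Nat.card {c : ClassGroup (𝓞 L) // c ^ q = 1 ∧
        c * ClassGroup.mulEquiv (AmbiguousClass.intAut σ) c *
          ClassGroup.mulEquiv (AmbiguousClass.intAut σ) (ClassGroup.mulEquiv (AmbiguousClass.intAut σ) c) = 1} :=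
    Nat.card_congr (Equiv.subtypeEquivRight fun c => by simp only [hmemN, hs_apply])
  rw [← e1, key, e2, e3]

end ClassGroup

end Summit.BirchSwinnertonDyer.BirchSwinnertonDyer.Theorems.SignedMuAtTwo.NonsquareDescent
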